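/-
Copyright (c) 2026 the pub-hodgecm-mathlib formalisation cell (harness21).  Prover seat hodgecm-mathlib-LH4-p08 (g2), req620 Track A «(D-RAM) FOUR-FRAME» squad, unit U2H_HSide:
(ρ) `stub_U2H_rowsR_hFamily_unit0`, child (b′) «H-SIDE DEPTH IDENTITY» (dealer LH4-plan (g10) WORD #45 (1) ∕ #47 ∕ #53 (A); p06 target text 335041993678acc8) — THE ASSEMBLY in the
AFFINE shape of LH4-p12 (g0)'s law₁ (2026-09-03T23:14Z ∕ 23:20Z), census-free.  2026-09-03.
-/
import Summits.HodgeConjecture.HodgeConjecture.Theorems.F0P3cDyRamRowOneReductionDepth    -- ★ p855481 `rowOne_of_hSideIdentity_depth` (the consumer of `hH`); brings ★ p855238 «T∕P», ★ «E» p855274 (`eventually_nhds_one_valued_trace_sub_two_le`), ★ `eventually_nhds_one_valued_sub_one_le`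
import Summits.HodgeConjecture.HodgeConjecture.Theorems.F0P3cDyRamRowOneHSideArithmetic    -- ★ p855518 (b′-5) (this seat): `max_zero_zpow_sub_zpow`
import Summits.HodgeConjecture.HodgeConjecture.Theorems.F0P3cDyRamFourFrameHFamilyDefs     -- DEFS LEAF №5 `hFamily = ![1_{K_H}, 1_{K♯ × U₁}]`
import Summits.HodgeConjecture.HodgeConjecture.Theorems.F0P3cDyRamFourFrameHSideDefsR       -- ★ p855104 DEFS LEAF №2c-R (brings №1-R `shiftR`)
import HarnessLib

/-!
# Crux `H413`, line LH4 «(D-RAM) FOUR-FRAME» road — unit U2H (ii-H), (ρ) child (b′): THE ASSEMBLY of the H-side depth identity `hH` (ROW (1) of (ρ) by name) from an AFFINE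
# edge-ball closed form of the two H-side profiles (binder = the dictionary's output), the S-FREE radius law (binder = ★ depth law), and the two coefficient identities (law₁)

Cell `hodgecm-mathlib` (D-0151), FLOOR 0, crux item H413 = `stmt-HodgeConjecture-24833`, route of record `HCCMUnconditional`; squad F0∕P3c∕LH4 (req620).  THEOREMS ONLY (no `def`,
no instance, no notation, no `sorry`, default heartbeats; imports ★ only); lane `--supports stmt-HodgeConjecture-24833 --as helper` (count-neutral).

THE PICTURE (LH4-p12 (g0) census 23:14Z + law₁ 23:20Z, adopting REF5 R5-46 ∕ dealer WORD #53 (A) «explicit coef*»).  At a ramified non-split `w`, a `G`-regular type-(1) `γ_H` with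
distinct norm-one `w`-eigenvalues of depth `N` is of VERTEX type, `N = 2n + d` exactly (★ p855609 `depth_eq_two_mul_add`, S-FREE), and on the `(q+1)`-regular `SL₂(L⁺_v)`-tree both
stable classes fix the same edge-ball: the VERTEX-stabiliser profile sees `V(n) = 2(q^{n+1} − 1)∕(q − 1)` vertices, the EDGE-stabiliser profile `V(n) − 1` edges (which of `K_H`, `K♯`
is which is the `√π ∕ √u`-type of `w`, i.e. the parity of `d` — INSIDE the dictionary).  So per profile `Φ^st(γ_H, hFamily s) = κ_s·V(n) + λ_s` is AFFINE in `V(n)` with Haar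
constants, and ROW (1) — `Σ_s coef_s·Φ^st(γ_H, hFamily s) = C·4·max 0 (q^{(n₃+2−d)∕2} − q^{S})∕(q − 1)`, `S = shiftR d t_E` — holds for ALL admissible depths iff
law₁: `Σ_s coef_s κ_s = 2C` and `Σ_s coef_s λ_s = −C·4(q^S − 1)∕(q − 1)` (the shift is carried by the constant term, NOT by the radius), PROVIDED the depth is large enough that the
clipped right-hand side is the plain difference (`(n₃ + 2 − d)∕2 ≥ S`): below that the frozen RHS is `0` while law₁'s left side is not, so the witness neighbourhood `V` MUST exclude
shallow elements — §1 supplies it (eigenvalue depth → ∞ near `1`).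

WHAT IS PROVED.
* §1 `eventually_nhds_one_le_depth` — for every `N₁`, EVENTUALLY near `1 ∈ H_v`: if the `w`-characteristic polynomial of `γ_H.1` has roots `α ≠ γ` with `|α − γ| = |ϖ|^N` then
  `N₁ ≤ N` (`(α − γ)² = (tr − 2)² + 4(tr − 2) − 4(det − 1)` and ★ «E»'s continuity of `tr`, `det` at `1`).
* §2 `sum_coef_mul_eq_of_affine` — the arithmetic: `Φ_s = κ_s·V(n) + λ_s`, `n + 1 = R`, `S ≤ R`, law₁ ⇒ `Σ_s coef_s Φ_s = C·↑(4·max 0 (q^R − q^S)∕(q − 1))`.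
* §3 HEAD **`hH_rowOne_hFamily_of_affine`** — CONCLUSION = the (b′) target text TOKEN FOR TOKEN (the `hH` of ★ p855481 at `(shiftR, depthOfRecord, tauOfRecord, 0, hFamily L w hw ϖ)`);
  HYPOTHESES = `hΦ` (the dictionary's affine output near `1`, on `G`-regular `γ_H` with distinct norm-one roots of depth `N ≥ depthOfRecord d`, `N + d` even — ellipticity is NOT a
  binder: ★ p855564 `not_exists_conj_glDiagonal_of_isRoot_of_norm_one`), `hn` (S-free radius law, ★ p855609's shape), `hκ`, `hlam` (law₁ at the explicit `coef*` of WORD #53 (A)).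
  So ROW (1) of (ρ) = `rowOne_of_hSideIdentity_depth shiftR depthOfRecord tauOfRecord 0 … (hFamily L w hw ϖ) coef (hH_rowOne_hFamily_of_affine … hΦ hn hκ hlam)` (tie probe HOME).
HONEST LABEL.  Count-neutral; no census law is asserted (closed form, radius law and law₁ are HYPOTHESES); `HC_CM` is proved only modulo the 7 printed citations (2 remaining named
inputs: hLiu418 = `stmt-HodgeConjecture-24832`, h413 = `stmt-HodgeConjecture-24833`) until rung 0 closes.

## References
* [Rogawski1990] J. D. Rogawski, *Automorphic Representations of Unitary Groups in Three Variables*, Ann. of Math. Stud. 123 (1990): §4.9 Prop. 4.9.1 (a)(b) p. 55,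
  Lemma 4.9.3 p. 56 (the H-side of the unit transfer), §3.6 pp. 28–29 (type (1)), Prop. 8.1.3 p. 116 («for `t` sufficiently close to `1`»).
* [LabesseLanglands1979] J.-P. Labesse, R. P. Langlands, *L-indistinguishability for SL(2)*, Canad. J. Math. 31 (1979), §2 (2.2) (`δ_m = 2q^m`: edge-ball counts).
* [HornJohnson2013] R. A. Horn, C. R. Johnson, *Matrix Analysis* (2nd ed., 2013), 2.4.P16 (eigenvalues of a `2 × 2` matrix from trace and determinant).
-/

set_option autoImplicit false

noncomputable section

namespace Summit.HodgeConjecture.HodgeConjecture.Cruxes.H413.F0P3cDyRamRowOneHSideAssembly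

open MeasureTheory Measure NumberField IsDedekindDomain Topology Filter Polynomial
open Literature.NumberTheory.Automorphic Literature.NumberTheory.Automorphic.UnitaryGroup Literature.NumberTheory.Automorphic.IntegralReduction
open Literature.NumberTheory.Automorphic.UnitaryLatticeTree Literature.NumberTheory.Automorphic.HermitianLattice
open Literature.NumberTheory.Rogawski1990 Literature.NumberTheory.GaloisRepresentations
open Literature.NumberTheory.Automorphic.UnitaryThreeFourFrame
open Summit.HodgeConjecture.HodgeConjecture.Cruxes.H413.F0P3cDyRamFourFrameHSideDefs
open Summit.HodgeConjecture.HodgeConjecture.Cruxes.H413.F0P3cDyRamFourFrameHSideDefsR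
open Summit.HodgeConjecture.HodgeConjecture.Cruxes.H413.F0P3cDyRamFourFrameHFamilyDefs
open Summit.HodgeConjecture.HodgeConjecture.Cruxes.H413.F0P3cDyRamFourFrameLawDefsR (shiftT shiftR)
open Summit.HodgeConjecture.HodgeConjecture.Cruxes.H413.F0P3cDyRamRowOneDepthToken
open Summit.HodgeConjecture.HodgeConjecture.Cruxes.H413.F0P3cDyRamRowOneRootDepth
open Summit.HodgeConjecture.HodgeConjecture.Cruxes.H413.F0P3cDyRamCayleySignFPartProd (valued_eq_one_of_mul_map_eq_one)
open Summit.HodgeConjecture.HodgeConjecture.Cruxes.H413.F0P3cDyRamRowOneHSideArithmetic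
open scoped Matrix MatrixGroups Classical ValuativeRel WithZero

/-! ## §1 Near `1 ∈ H_v` the `w`-eigenvalue depth tends to `∞` -/

section Depth

variable (L : Type) [Field L] [NumberField L] [IsCMField L] (v : HeightOneSpectrum (𝓞 ↥(maximalRealSubfield L)))
  (w : UnitaryGroup.PlacesOver L v)

omit [IsCMField L] in
/-- `(α − γ)² = (tr − 2)² + 4(tr − 2) − 4(det − 1)` for two distinct roots of the characteristic polynomial of a `2 × 2` matrix. [cite: HornJohnson2013, 2.4.P16] -/
theorem sub_sq_eq_of_isRoot_of_isRoot {K : Type} [Field K] (M : Matrix (Fin 2) (Fin 2) K) {α γ : K} (hα : M.charpoly.IsRoot α) (hγ : M.charpoly.IsRoot γ) (hαγ : α ≠ γ) :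
    (α - γ) * (α - γ) = (M.trace - 2) * (M.trace - 2) + 4 * (M.trace - 2) - 4 * (M.det - 1) := by
  have e : ∀ z : K, M.charpoly.eval z = z ^ 2 - M.trace * z + M.det := fun z => by
    rw [Matrix.charpoly_fin_two, Matrix.trace_fin_two]; simp
  have hα' : α ^ 2 - M.trace * α + M.det = 0 := by rw [← e]; exact hα.eq_zero
  have hγ' : γ ^ 2 - M.trace * γ + M.det = 0 := by rw [← e]; exact hγ.eq_zero
  have hsub : (α - γ) * (α + γ - M.trace) = 0 := by linear_combination hα' - hγ'
  have htr : M.trace = α + γ := by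
    have h := (mul_eq_zero.1 hsub).resolve_left (sub_ne_zero.2 hαγ)
    linear_combination -h
  have hdet : M.det = α * γ := by rw [htr] at hα'; linear_combination hα'
  rw [htr, hdet]; ring

/-- **EIGENVALUE DEPTH → ∞ NEAR `1`.**  For every `N₁`, eventually near `1 ∈ H_v`: whenever the `w`-characteristic polynomial of `γ_H.1` has two distinct roots `α ≠ γ` with
`|α − γ|_w = |ϖ|^N` (`ϖ` a uniformiser of `L_w`), `N₁ ≤ N`.  (`|tr g_w − 2|, |det g_w − 1| ≤ |ϖ|^{2N₁}` eventually by ★ «E» ∕ ★ `eventually_nhds_one_valued_sub_one_le`; then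
`|α − γ|² ≤ |ϖ|^{2N₁}` by §1's identity and `|4| ≤ 1`.) [cite: Rogawski1990, Prop. 8.1.3 p. 116] [cite: HornJohnson2013, 2.4.P16] -/
theorem eventually_nhds_one_le_depth (ϖ : (w.1.adicCompletion L)) (hϖ : Valued.v ϖ = WithZero.exp (-1 : ℤ)) (N₁ : ℕ) :
    ∀ᶠ γH : ((UnitaryGroup.cmDatum L 2 (Matrix.of fun i j : Fin 2 => if i.val + j.val + 1 = 2 then (1 : L) else 0)).Local v × (UnitaryGroup.cmDatum L 1 (Matrix.of fun i j : Fin 1 => if i.val + j.val + 1 = 1 then (1 : L) else 0)).Local v) in 𝓝 1,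
      ∀ (α γ : (w.1.adicCompletion L)), ((((γH).1.val : GL (Fin 2) (UnitaryGroup.LocalRing L v)).val.map (Pi.evalRingHom (fun w' : UnitaryGroup.PlacesOver L v => w'.1.adicCompletion L) w))).charpoly.IsRoot α → ((((γH).1.val : GL (Fin 2) (UnitaryGroup.LocalRing L v)).val.map (Pi.evalRingHom (fun w' : UnitaryGroup.PlacesOver L v => w'.1.adicCompletion L) w))).charpoly.IsRoot γ → α ≠ γ →
        ∀ N : ℕ, Valued.v (α - γ) = WithZero.exp (-(N : ℤ)) → N₁ ≤ N := by
  have hϖ0 : ϖ ≠ 0 := fun h0 => by rw [h0, map_zero] at hϖ; exact WithZero.coe_ne_zero hϖ.symm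
  have hc0 : ϖ ^ (2 * N₁) ≠ 0 := pow_ne_zero _ hϖ0
  have hvc : Valued.v (ϖ ^ (2 * N₁)) = WithZero.exp (-(2 * N₁ : ℤ)) := by
    rw [map_pow, hϖ, ← WithZero.exp_nsmul, nsmul_eq_mul]; push_cast; ring_nf
  have hc1 : Valued.v (ϖ ^ (2 * N₁)) ≤ 1 := by
    rw [hvc, ← WithZero.exp_zero, WithZero.exp_le_exp]; omega
  have h4 : Valued.v (4 : w.1.adicCompletion L) ≤ 1 := by
    rw [show (4 : w.1.adicCompletion L) = 2 * 2 by norm_num, map_mul]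
    exact mul_le_one' (valued_two_le_one L v w) (valued_two_le_one L v w)
  filter_upwards [eventually_nhds_one_valued_sub_one_le L v w hc0, eventually_nhds_one_valued_trace_sub_two_le L v w hc0] with γH h₁ h₂
  intro α γ hα hγ hαγ N hN
  have hd := h₁.2
  have key := sub_sq_eq_of_isRoot_of_isRoot (((γH).1.val : GL (Fin 2) (UnitaryGroup.LocalRing L v)).val.map (Pi.evalRingHom (fun w' : UnitaryGroup.PlacesOver L v => w'.1.adicCompletion L) w)) hα hγ hαγ
  -- valuation of the right-hand side is `≤ |ϖ|^{2N₁}`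
  have hsq : Valued.v (α - γ) * Valued.v (α - γ) ≤ Valued.v (ϖ ^ (2 * N₁)) := by
    rw [← map_mul, key]
    refine le_trans (Valuation.map_sub _ _ _) (max_le (le_trans (Valuation.map_add _ _ _) (max_le ?_ ?_)) ?_)
    · rw [map_mul]; exact le_trans (mul_le_mul' h₂ h₂) (mul_le_of_le_one_left' hc1)
    · rw [map_mul]; exact le_trans (mul_le_mul' h4 h₂) (by rw [one_mul])
    · rw [map_mul]; exact le_trans (mul_le_mul' h4 hd) (by rw [one_mul])
  rw [hN, hvc, ← WithZero.exp_add, WithZero.exp_le_exp] at hsq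
  omega

end Depth

/-! ## §2 The arithmetic in the affine shape -/

/-- **AFFINE ARITHMETIC CORE.**  `q ≥ 2`, `S ≤ R`, `n + 1 = R`, `Φ_s = κ_s·V + λ_s` with `V = 2(q^{n+1} − 1)∕(q − 1)`, and law₁ (`Σ_s coef_s κ_s = 2C`, `Σ_s coef_s λ_s = −C·4(q^S − 1)∕(q − 1)`)
give `Σ_s coef_s Φ_s = C·↑(4·max 0 (q^R − q^S)∕(q − 1))` — the (b′) right-hand side shape. [cite: LabesseLanglands1979, §2 (2.2)] [cite: Rogawski1990, §4.9 Lemma 4.9.3 p. 56] -/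
theorem sum_coef_mul_eq_of_affine {q : ℕ} (hq : 1 < q) {R S : ℤ} (hSR : S ≤ R) {n : ℕ} (hn : (n : ℤ) + 1 = R) (C : ℂ) (coef κ lam Φ : Fin 2 → ℂ)
    (hΦ : ∀ s, Φ s = κ s * (((2 * ((q : ℚ) ^ (n + 1) - 1) / ((q : ℚ) - 1) : ℚ)) : ℂ) + lam s)
    (hκ : coef 0 * κ 0 + coef 1 * κ 1 = 2 * C) (hlam : coef 0 * lam 0 + coef 1 * lam 1 = -(C * (((4 * ((q : ℚ) ^ S - 1) / ((q : ℚ) - 1) : ℚ)) : ℂ))) :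
    ∑ s, coef s * Φ s = C * (((4 * max 0 ((q : ℚ) ^ R - (q : ℚ) ^ S) / ((q : ℚ) - 1) : ℚ)) : ℂ) := by
  have hq1 : (1 : ℚ) ≤ q := by exact_mod_cast hq.le
  have hV : (q : ℚ) ^ (n + 1) = (q : ℚ) ^ R := by rw [← zpow_natCast, Nat.cast_succ, hn]
  rw [max_zero_zpow_sub_zpow _ hq1 hSR, Fin.sum_univ_two, hΦ 0, hΦ 1, hV]
  push_cast at hlam ⊢
  linear_combination (2 * ((q : ℂ) ^ R - 1) / ((q : ℂ) - 1)) * hκ + hlam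

/-! ## §3 HEAD — the (b′) assembly -/

/-- **(b′) ASSEMBLY — the H-side depth identity `hH` of ★ p855481 at `(shiftR, depthOfRecord, tauOfRecord, 0, hFamily)` from the dictionary's AFFINE output (`hΦ`), the S-free
radius law (`hn`) and law₁ (`hκ`, `hlam`).**  The conclusion is the (b′) target text token for token; ROW (1) of (ρ) :=
`rowOne_of_hSideIdentity_depth shiftR depthOfRecord tauOfRecord 0 … (hFamily L w hw ϖ) coef ‹this›`.  The witness neighbourhood is `V_dict ∩ V_deep`, `V_deep` from §1 with
`N₁ := d + 2·|shiftR d t_E|`, so that the clipped right-hand side is the plain difference on it.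
[cite: Rogawski1990, §4.9 Prop. 4.9.1, Lemma 4.9.3 p. 56; §3.6 pp. 28–29; Prop. 8.1.3 p. 116] [cite: LabesseLanglands1979, §2 (2.2)] -/
theorem hH_rowOne_hFamily_of_affine
    (L : Type) [Field L] [NumberField L] [IsCMField L]
      {v : HeightOneSpectrum (𝓞 ↥(maximalRealSubfield L))} (w : UnitaryGroup.PlacesOver L v)
      (hw : IsCMField.complexConj L • w.1 = w.1) (he : v.asIdeal.ramificationIdx' w.1.asIdeal ≠ 1)
      (ϖ : (w.1.adicCompletion L)) (d tE : ℕ) (hD : IsRamifiedQuadraticDatum (galAdicCompletionMap (L := L) (IsCMField.complexConj L) hw) ϖ d tE)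
      [Fintype (Valued.ResidueField (w.1.adicCompletion L))] (δ : (w.1.adicCompletion L)) (hδ : (galAdicCompletionMap (L := L) (IsCMField.complexConj L) hw) δ = -δ) (hδ0 : δ ≠ 0)
      (μ : HeckeCharacter L)
      [MeasurableSpace ((UnitaryGroup.cmDatum L 2 (Matrix.of fun i j : Fin 2 => if i.val + j.val + 1 = 2 then (1 : L) else 0)).Local v × (UnitaryGroup.cmDatum L 1 (Matrix.of fun i j : Fin 1 => if i.val + j.val + 1 = 1 then (1 : L) else 0)).Local v)] [BorelSpace ((UnitaryGroup.cmDatum L 2 (Matrix.of fun i j : Fin 2 => if i.val + j.val + 1 = 2 then (1 : L) else 0)).Local v × (UnitaryGroup.cmDatum L 1 (Matrix.of fun i j : Fin 1 => if i.val + j.val + 1 = 1 then (1 : L) else 0)).Local v)]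
      [∀ a : ((UnitaryGroup.cmDatum L 2 (Matrix.of fun i j : Fin 2 => if i.val + j.val + 1 = 2 then (1 : L) else 0)).Local v × (UnitaryGroup.cmDatum L 1 (Matrix.of fun i j : Fin 1 => if i.val + j.val + 1 = 1 then (1 : L) else 0)).Local v), MeasurableSpace (((UnitaryGroup.cmDatum L 2 (Matrix.of fun i j : Fin 2 => if i.val + j.val + 1 = 2 then (1 : L) else 0)).Local v × (UnitaryGroup.cmDatum L 1 (Matrix.of fun i j : Fin 1 => if i.val + j.val + 1 = 1 then (1 : L) else 0)).Local v) ⧸ Subgroup.centralizer ({a} : Set ((UnitaryGroup.cmDatum L 2 (Matrix.of fun i j : Fin 2 => if i.val + j.val + 1 = 2 then (1 : L) else 0)).Local v × (UnitaryGroup.cmDatum L 1 (Matrix.of fun i j : Fin 1 => if i.val + j.val + 1 = 1 then (1 : L) else 0)).Local v)))]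
      [∀ a : ((UnitaryGroup.cmDatum L 2 (Matrix.of fun i j : Fin 2 => if i.val + j.val + 1 = 2 then (1 : L) else 0)).Local v × (UnitaryGroup.cmDatum L 1 (Matrix.of fun i j : Fin 1 => if i.val + j.val + 1 = 1 then (1 : L) else 0)).Local v), BorelSpace (((UnitaryGroup.cmDatum L 2 (Matrix.of fun i j : Fin 2 => if i.val + j.val + 1 = 2 then (1 : L) else 0)).Local v × (UnitaryGroup.cmDatum L 1 (Matrix.of fun i j : Fin 1 => if i.val + j.val + 1 = 1 then (1 : L) else 0)).Local v) ⧸ Subgroup.centralizer ({a} : Set ((UnitaryGroup.cmDatum L 2 (Matrix.of fun i j : Fin 2 => if i.val + j.val + 1 = 2 then (1 : L) else 0)).Local v × (UnitaryGroup.cmDatum L 1 (Matrix.of fun i j : Fin 1 => if i.val + j.val + 1 = 1 then (1 : L) else 0)).Local v)))]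
      (mH : OrbitalMeasureFamily ((UnitaryGroup.cmDatum L 2 (Matrix.of fun i j : Fin 2 => if i.val + j.val + 1 = 2 then (1 : L) else 0)).Local v × (UnitaryGroup.cmDatum L 1 (Matrix.of fun i j : Fin 1 => if i.val + j.val + 1 = 1 then (1 : L) else 0)).Local v))
      (C : ℂ) (coef κ lam : Fin 2 → ℂ) (n : ℕ → ℕ)
      (hΦ : ∃ V ∈ 𝓝 (1 : ((UnitaryGroup.cmDatum L 2 (Matrix.of fun i j : Fin 2 => if i.val + j.val + 1 = 2 then (1 : L) else 0)).Local v × (UnitaryGroup.cmDatum L 1 (Matrix.of fun i j : Fin 1 => if i.val + j.val + 1 = 1 then (1 : L) else 0)).Local v)), ∀ γH ∈ V, IsLocalGRegular L v γH →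
        ∀ (α γ : (w.1.adicCompletion L)), ((((γH).1.val : GL (Fin 2) (UnitaryGroup.LocalRing L v)).val.map (Pi.evalRingHom (fun w' : UnitaryGroup.PlacesOver L v => w'.1.adicCompletion L) w))).charpoly.IsRoot α → ((((γH).1.val : GL (Fin 2) (UnitaryGroup.LocalRing L v)).val.map (Pi.evalRingHom (fun w' : UnitaryGroup.PlacesOver L v => w'.1.adicCompletion L) w))).charpoly.IsRoot γ → α ≠ γ → α * (galAdicCompletionMap (L := L) (IsCMField.complexConj L) hw) α = 1 → γ * (galAdicCompletionMap (L := L) (IsCMField.complexConj L) hw) γ = 1 →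
          ∀ N : ℕ, Valued.v (α - γ) = WithZero.exp (-(N : ℤ)) → depthOfRecord d ≤ N → (N + d) % 2 = 0 →
            ∀ s : Fin 2, stableOrbitalIntegralRel (IsLocalStablyConjH L v) mH (hFamily L w hw ϖ s) γH =
              κ s * (((2 * ((Fintype.card (Valued.ResidueField (w.1.adicCompletion L)) : ℚ) ^ (n N + 1) - 1) / ((Fintype.card (Valued.ResidueField (w.1.adicCompletion L)) : ℚ) - 1) : ℚ)) : ℂ) + lam s)
      (hn : ∀ N : ℕ, depthOfRecord d ≤ N → (N + d) % 2 = 0 → ((n N : ℕ) : ℤ) + 1 = ((N : ℤ) + 2 - d) / 2)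
      (hκ : coef 0 * κ 0 + coef 1 * κ 1 = 2 * C)
      (hlam : coef 0 * lam 0 + coef 1 * lam 1 = -(C * (((4 * ((Fintype.card (Valued.ResidueField (w.1.adicCompletion L)) : ℚ) ^ (shiftR d tE) - 1) / ((Fintype.card (Valued.ResidueField (w.1.adicCompletion L)) : ℚ) - 1) : ℚ)) : ℂ))) :
        (∃ V ∈ 𝓝 (1 : ((UnitaryGroup.cmDatum L 2 (Matrix.of fun i j : Fin 2 => if i.val + j.val + 1 = 2 then (1 : L) else 0)).Local v × (UnitaryGroup.cmDatum L 1 (Matrix.of fun i j : Fin 1 => if i.val + j.val + 1 = 1 then (1 : L) else 0)).Local v)), ∀ γH ∈ V, IsLocalGRegular L v γH →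
          ∀ (f : Fin 4 → Fin 3 → (Fin 3 → (w.1.adicCompletion L))) (_hf : IsFourFrameFamily (galAdicCompletionMap (L := L) (IsCMField.complexConj L) hw) f)
        (a b z : (w.1.adicCompletion L)) (_ha : a * (galAdicCompletionMap (L := L) (IsCMField.complexConj L) hw) a = 1) (_hb : b * (galAdicCompletionMap (L := L) (IsCMField.complexConj L) hw) b = 1) (_hz : z * (galAdicCompletionMap (L := L) (IsCMField.complexConj L) hw) z = 1)
        (_hzγ : z = finGammaTwo L v γH w) (_hra : ((((γH).1.val : GL (Fin 2) (UnitaryGroup.LocalRing L v)).val.map (Pi.evalRingHom (fun w' : UnitaryGroup.PlacesOver L v => w'.1.adicCompletion L) w))).charpoly.IsRoot (z * (a * a))) (_hrb : ((((γH).1.val : GL (Fin 2) (UnitaryGroup.LocalRing L v)).val.map (Pi.evalRingHom (fun w' : UnitaryGroup.PlacesOver L v => w'.1.adicCompletion L) w))).charpoly.IsRoot (z * (b * b)))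
        (_ha1 : Valued.v (a - 1) < Valued.v (2 : (w.1.adicCompletion L))) (_hb1 : Valued.v (b - 1) < Valued.v (2 : (w.1.adicCompletion L)))
        (n₁ n₂ n₃ : ℕ) (_hE : IsElementDatum (galAdicCompletionMap (L := L) (IsCMField.complexConj L) hw) ϖ (depthOfRecord d) (a * a) (b * b) n₁ n₂ n₃)
        (k : ℕ) (_hk : 2 * k + d = n₁ + n₂ + n₃ + 2)
        (Γ : Fin 4 → GL (Fin 3) (w.1.adicCompletion L)) (_hΓ : ∀ b', (Γ b' : Matrix (Fin 3) (Fin 3) (w.1.adicCompletion L)) = frameElt (galAdicCompletionMap (L := L) (IsCMField.complexConj L) hw) f b' (a * a) (b * b))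
        (tb : Fin 4 → ((UnitaryGroup.cmDatum L 3 (Matrix.of fun i j : Fin 3 => if i.val + j.val + 1 = 3 then (1 : L) else 0)).Local v)) (_htb : ∀ b', ((((localNonsplitEquiv (IsCMField.complexConj L) (Matrix.of fun i j : Fin 3 => if i.val + j.val + 1 = 3 then (1 : L) else 0) (IsCMField.complexConj_ne_one L) w hw (tb b') :
              ↥(unitaryGroupOfForm (galAdicCompletionMap (L := L) (IsCMField.complexConj L) hw) (placeForm (Matrix.of fun i j : Fin 3 => if i.val + j.val + 1 = 3 then (1 : L) else 0) w.1))) : GL (Fin 3) (w.1.adicCompletion L)) : Matrix (Fin 3) (Fin 3) (w.1.adicCompletion L))) = z • (Γ b' : Matrix (Fin 3) (Fin 3) (w.1.adicCompletion L)))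
            (i : Fin 3) (B : ℤ), 2 * B = ((![n₁, n₂, n₃] : Fin 3 → ℕ) i : ℤ) - d + 2 - 2 * shiftR d tE →
            (∀ t' : ((UnitaryGroup.cmDatum L 3 (Matrix.of fun i j : Fin 3 => if i.val + j.val + 1 = 3 then (1 : L) else 0)).Local v), IsLocalNormPair L (Matrix.of fun i j : Fin 3 => if i.val + j.val + 1 = 3 then (1 : L) else 0) v γH t' ↔ ∃ b', ConjClasses.mk t' = ConjClasses.mk (tb b')) →
            (∀ b' : Fin 4, ((finExplicitCollection L (Matrix.of fun i j : Fin 3 => if i.val + j.val + 1 = 3 then (1 : L) else 0) μ (finExplicitDelta_conj_left_all L (Matrix.of fun i j : Fin 3 => if i.val + j.val + 1 = 3 then (1 : L) else 0) μ) (finExplicitDelta_conj_right_all L (Matrix.of fun i j : Fin 3 => if i.val + j.val + 1 = 3 then (1 : L) else 0) μ)) v).Δ γH (tb b') = ((finExplicitCollection L (Matrix.of fun i j : Fin 3 => if i.val + j.val + 1 = 3 then (1 : L) else 0) μ (finExplicitDelta_conj_left_all L (Matrix.of fun i j : Fin 3 => if i.val + j.val + 1 = 3 then (1 : L) else 0)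 μ) (finExplicitDelta_conj_right_all L (Matrix.of fun i j : Fin 3 => if i.val + j.val + 1 = 3 then (1 : L) else 0) μ)) v).Δ γH (tb 0) * (kappaChar i b' : ℂ)) →
            ∑ s, coef s * stableOrbitalIntegralRel (IsLocalStablyConjH L v) mH (hFamily L w hw ϖ s) γH =
              C * (((4 : ℚ) * max 0 ((Fintype.card (Valued.ResidueField (w.1.adicCompletion L)) : ℚ) ^ (((n₃ : ℤ) + 2 - d) / 2) - (Fintype.card (Valued.ResidueField (w.1.adicCompletion L)) : ℚ) ^ (shiftR d tE - (if (0 : ℕ) = 0 then 0 else tauOfRecord d))) / ((Fintype.card (Valued.ResidueField (w.1.adicCompletion L)) : ℚ) - 1) : ℚ) : ℂ)) := by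
  obtain ⟨V₁, hV₁, h⟩ := hΦ
  have hϖ : Valued.v ϖ = WithZero.exp (-1 : ℤ) := hD.2.2.1
  obtain ⟨V₂, hV₂, hdeep⟩ := (eventually_nhds_one_le_depth L v w ϖ hϖ (d + 2 * (shiftR d tE).natAbs)).exists_mem
  refine ⟨V₁ ∩ V₂, Filter.inter_mem hV₁ hV₂, ?_⟩
  intro γH hγ hreg f _hf a b z ha hb hz _hzγ hra hrb _ha1 _hb1 n₁ n₂ n₃ hE k hk Γ _hΓ tb _htb i B _hB _hnorm _hrel
  -- the element datum at `(a², b²)`: distinct squares, depth `n₃ ≥ depthOfRecord d`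
  have hab : a * a ≠ b * b := hE.2.2.1
  have hn₁ : Valued.v (b * b - 1) = Valued.v ϖ ^ n₁ := hE.2.2.2.2.2.1
  have hn₂ : Valued.v (a * a - 1) = Valued.v ϖ ^ n₂ := hE.2.2.2.2.2.2.1
  have hn₃ : Valued.v (a * a - b * b) = Valued.v ϖ ^ n₃ := hE.2.2.2.2.2.2.2.1
  have hN₀ : depthOfRecord d ≤ n₃ := hE.2.2.2.2.2.2.2.2.2.2
  -- parity: `n₁ + n₂` even (★ «T∕P»), so `n₃ + d` even by `2k + d = n₁ + n₂ + n₃ + 2`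
  obtain ⟨hev, -⟩ := valued_rootProduct_eq_toPlace_pow_half_of_datum L v w hw he hD hδ hδ0 ha hb hz hn₂ hn₁
  have hpar : (n₃ + d) % 2 = 0 := by omega
  -- the roots `α = z·a²`, `γ = z·b²`: distinct, norm one, of depth `n₃`
  have hvz : Valued.v z = 1 := valued_eq_one_of_mul_map_eq_one L v w hw hz
  have hz0 : z ≠ 0 := fun h0 => by rw [h0, map_zero] at hvz; exact zero_ne_one hvz
  have hαγ : z * (a * a) ≠ z * (b * b) := fun h' => hab (mul_left_cancel₀ hz0 h')
  have hα1 : z * (a * a) * (galAdicCompletionMap (L := L) (IsCMField.complexConj L) hw) (z * (a * a)) = 1 := by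
    rw [map_mul, map_mul]
    calc z * (a * a) * ((galAdicCompletionMap (L := L) (IsCMField.complexConj L) hw) z * ((galAdicCompletionMap (L := L) (IsCMField.complexConj L) hw) a * (galAdicCompletionMap (L := L) (IsCMField.complexConj L) hw) a))
        = (z * (galAdicCompletionMap (L := L) (IsCMField.complexConj L) hw) z) * ((a * (galAdicCompletionMap (L := L) (IsCMField.complexConj L) hw) a) * (a * (galAdicCompletionMap (L := L) (IsCMField.complexConj L) hw) a)) := by ring
      _ = 1 := by rw [hz, ha, one_mul, one_mul]
  have hγ1 : z * (b * b) * (galAdicCompletionMap (L := L) (IsCMField.complexConj L) hw) (z * (b * b)) = 1 := by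
    rw [map_mul, map_mul]
    calc z * (b * b) * ((galAdicCompletionMap (L := L) (IsCMField.complexConj L) hw) z * ((galAdicCompletionMap (L := L) (IsCMField.complexConj L) hw) b * (galAdicCompletionMap (L := L) (IsCMField.complexConj L) hw) b))
        = (z * (galAdicCompletionMap (L := L) (IsCMField.complexConj L) hw) z) * ((b * (galAdicCompletionMap (L := L) (IsCMField.complexConj L) hw) b) * (b * (galAdicCompletionMap (L := L) (IsCMField.complexConj L) hw) b)) := by ring
      _ = 1 := by rw [hz, hb, one_mul, one_mul]
  have hdepth : Valued.v (z * (a * a) - z * (b * b)) = WithZero.exp (-(n₃ : ℤ)) := by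
    rw [← mul_sub, map_mul, hvz, one_mul, hn₃, hϖ, ← WithZero.exp_nsmul, nsmul_eq_mul, mul_neg, mul_one]
  -- the witness neighbourhood excludes shallow elements: `n₃ ≥ d + 2|S|`, so `S ≤ R`
  have hN₁ : d + 2 * (shiftR d tE).natAbs ≤ n₃ := hdeep γH hγ.2 (z * (a * a)) (z * (b * b)) hra hrb hαγ n₃ hdepth
  have hrad : ((n n₃ : ℕ) : ℤ) + 1 = ((n₃ : ℤ) + 2 - d) / 2 := hn n₃ hN₀ hpar
  have hSR : shiftR d tE - (if (0 : ℕ) = 0 then (0 : ℤ) else tauOfRecord d) ≤ ((n₃ : ℤ) + 2 - d) / 2 := by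
    rw [if_pos rfl, sub_zero]
    have := Int.le_natAbs (a := shiftR d tE)
    omega
  -- the dictionary's two values at depth `n₃` and the affine arithmetic
  have hΦs := h γH hγ.1 hreg (z * (a * a)) (z * (b * b)) hra hrb hαγ hα1 hγ1 n₃ hdepth hN₀ hpar
  have hq : 1 < Fintype.card (Valued.ResidueField (w.1.adicCompletion L)) := Fintype.one_lt_card
  have hlam' : coef 0 * lam 0 + coef 1 * lam 1 =
      -(C * (((4 * ((Fintype.card (Valued.ResidueField (w.1.adicCompletion L)) : ℚ) ^ (shiftR d tE - (if (0 : ℕ) = 0 then (0 : ℤ) else tauOfRecord d)) - 1) / ((Fintype.card (Valued.ResidueField (w.1.adicCompletion L)) : ℚ) - 1) : ℚ)) : ℂ)) := by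
    rw [if_pos rfl, sub_zero]; exact hlam
  exact sum_coef_mul_eq_of_affine hq hSR hrad C coef κ lam (fun s => stableOrbitalIntegralRel (IsLocalStablyConjH L v) mH (hFamily L w hw ϖ s) γH) hΦs hκ hlam'

end Summit.HodgeConjecture.HodgeConjecture.Cruxes.H413.F0P3cDyRamRowOneHSideAssembly

end
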